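import Summits.AtomisticToContinuum.Crystallization.Theorems.ChartedZeroExcessLayeredLatticeLiouvilleP

/-!
# Continuation (part B) of `ChartedZeroExcessLayeredLatticeLiouvilleP` — lens-2 g28 (18) part P 781f6b82 (503 l), PRE-SPLIT by hand-2 g12 for the gate's 400-line rule
(bodies byte-identical, same namespace `Summit.AtomisticToContinuum.Crystallization.Theorems.ChartedZeroExcessLayeredLatticeLiouville`; see the module docstring of part A for the content and tags).
-/

noncomputable section

open scoped BigOperators InnerProductSpace RealInnerProductSpace
open MeasureTheory Set Metric Filter Topology
open Summit.AtomisticToContinuum.Crystallization.Theorems.ChartedPlanarOrderRigidityDoor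
  (E3 IsClean IsNash IsCharted IsEStarGSC VisibleGap PertRegime atomsIn siteEnergy eStar BindingSurface)
open Summit.AtomisticToContinuum.Crystallization.Theorems.ChartedPlanarOrderDensityDichotomy (μS IsSep nK nK_nonneg excess)
open Summit.AtomisticToContinuum.Crystallization.Theorems.ChartedPlanarOrderMesoCut (IsDoorSet NearHom LayeredHom EnvClose)
open Summit.AtomisticToContinuum.Crystallization.Theorems.OverbindingBudgetLiouvilleDictionary (NearHomBD)
open Summit.AtomisticToContinuum.Crystallization.Theorems.ChartedPlanarOrderDoorLayered
  (TwoPeriodic DoorPeriodic PeriodicBulkGapDoor gap_and_pert_1_50_of_periodic NearHomL2BD nearHomL2BD_mono nearHomBD_of_nearHomL2BD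
   sq_le_finsum_mem not_nearHomL2BD_singleton envClose_mono)
open Summit.AtomisticToContinuum.Crystallization.Theorems.ChartedPlanarOrderDoorLayeredOsc (IsTwoShellAffineGood DoorPeriodicOsc)
open Summit.AtomisticToContinuum.Crystallization.Theorems.ChartedPlanarOrderCleanScaleP
  (IsCleanP IsDoorSetP DoorPeriodicP isDoorSetP_mono doorPeriodic_of_doorPeriodicP isDoorSetP_one_iff doorPeriodicP_one_iff)
open Literature.MathematicalPhysics.StatisticalMechanics (haggLabel barlowOffset layerNormal IsHaggSeq)

namespace Summit.AtomisticToContinuum.Crystallization.Theorems.ChartedZeroExcessLayeredLatticeLiouville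

/-! ## §I.5  The John-perturbative pieces with RIGID-chart hypothesis: K^ℓ, H_pert^ℓ and ★ the single leaf H♭^ℓ -/

/-- **K^ℓ(aHi; Λ, θ, s) «CoreExclusionPGL»** — part O's K_G^c with the flatness hypothesis in the RIGID-chart currency (`L` `s`-conformal about `a`, stacking
free).  John input = Hessian positivity on the L-CORE SLICE (TAG 174 (a‴)).  K_G ⇒ K^ℓ ⇒ K_G^c. [this file, g28] -/
def CoreExclusionPGL (aHi Λ θ s : ℝ) : Prop :=
  LatticeLiouvilleCert → LayeredLiouvilleCert → ∀ δ : ℝ, 0 < δ → ∀ a : ℝ, 0 < a → ∃ C : ℝ, 1 ≤ C ∧ ∃ M : ℝ, 1 ≤ M ∧ ∀ τ₀ : ℝ, 0 < τ₀ →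
    ∃ κ₁ : ℝ, 0 < κ₁ ∧ ∃ R₀ : ℝ, 0 < R₀ ∧
      ∀ S : Set E3, IsDoorSetPG aHi δ S → (∀ q ∈ S, IsTwoShellAffineGood θ S q) →
        ∀ η : ℝ, 0 < η → η ≤ κ₁ → ∀ R : ℝ, R₀ ≤ R →
          NearHomL2BDL a s Λ η 4 S (atomsIn (μS S) 0 (M * R)) → NearHomL2SupBD Λ (C * η) τ₀ 4 S (atomsIn (μS S) 0 R)

/-- **H_pert^ℓ(aHi; Λ, θ, s) «PerturbativeDecayPGL»** — part O's H_pert,G^c with the sup-flatness hypothesis in the RIGID-chart currency.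
H_pert,G ⇒ H_pert^ℓ ⇒ H_pert,G^c. [this file, g28] -/
def PerturbativeDecayPGL (aHi Λ θ s : ℝ) : Prop :=
  LatticeLiouvilleCert → LayeredLiouvilleCert → ∀ δ : ℝ, 0 < δ → ∀ a : ℝ, 0 < a → ∀ c : ℝ, 0 < c →
    ∃ τ₀ : ℝ, 0 < τ₀ ∧ ∃ κ₀ : ℝ, 0 < κ₀ ∧ ∃ M : ℝ, 1 ≤ M ∧ ∃ R₀ : ℝ, 0 < R₀ ∧
      ∀ S : Set E3, IsDoorSetPG aHi δ S → (∀ q ∈ S, IsTwoShellAffineGood θ S q) →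
        ∀ η : ℝ, 0 < η → η ≤ κ₀ → ∀ R : ℝ, R₀ ≤ R →
          NearHomL2SupBDL a s Λ η τ₀ 4 S (atomsIn (μS S) 0 (M * R)) → NearHomL2BD Λ (c * η) 4 S (atomsIn (μS S) 0 R)

/-- ★ **H♭^ℓ(aHi; Λ, θ, s) «HalvingBasinPGL»** — THE ONE JOHN LEAF OF THE MINIMISING DOOR: one-step ε-regularity for MINIMISERS with rigid-chart hypothesis
and NO sup clause: for every δ and every scale `a > 0` there are a basin `κ₀ > 0`, a ratio `M ≥ 1` and a floor `R₀ > 0` such that on θ-good `aHi`-GSC-door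
sets «`η`-flat at radius `M·R` under an `s`-conformal chart about `a` (`η ≤ κ₀`, `R ≥ R₀`) ⇒ `η/2`-flat at radius `R`».  REGULARITY-type for minimisers
(discrete Evans–Giaquinta–Modica: Caccioppoli by minimality against the healed chart patch at equal particle number — pointwise sup-smallness NOT required —,
`L_lay`-harmonic approximation by `LayeredLiouvilleCert`, linear decay, smallness); John input on the L-core slice (TAG 174 (a‴)).  H♭_G ⇒ H♭^ℓ ⇒ H♭^c;
★ H♭_G ⟸ Z_L ∧ H♭^ℓ (PROVED); nothing lost against the sup-route: H♭_G ⟸ Z_L ∧ Z_L^sup ∧ K^ℓ ∧ H_pert^ℓ (PROVED).  UNDECIDED · TRUE-type · ATTACKABLE·L.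
Why it might fail: a clean-but-linearly-unstable stacking at conformal `L` ((a‴) negative — then H♭^c + W), or failure of strong compactness in the discrete
Caccioppoli step at the clean-tube edge `θ = 1/16`. [this file, g28] -/
def HalvingBasinPGL (aHi Λ θ s : ℝ) : Prop :=
  LatticeLiouvilleCert → LayeredLiouvilleCert → ∀ δ : ℝ, 0 < δ → ∀ a : ℝ, 0 < a → ∃ κ₀ : ℝ, 0 < κ₀ ∧ ∃ M : ℝ, 1 ≤ M ∧ ∃ R₀ : ℝ, 0 < R₀ ∧
    ∀ S : Set E3, IsDoorSetPG aHi δ S → (∀ q ∈ S, IsTwoShellAffineGood θ S q) →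
      ∀ η : ℝ, 0 < η → η ≤ κ₀ → ∀ R : ℝ, R₀ ≤ R →
        NearHomL2BDL a s Λ η 4 S (atomsIn (μS S) 0 (M * R)) → NearHomL2BD Λ (η / 2) 4 S (atomsIn (μS S) 0 R)

/-- **H♭^c(aHi; Λ, θ, s) «HalvingBasinPGC»** — the one-step halving with CORE-TUBE hypothesis (`NearHomL2BDC`: conformal `L` AND ideal stacking `w`); John input on
the core tube (TAG 174 (a), certified λ_rel ≥ 0.52).  H♭^ℓ ⇒ H♭^c; H♭_G ⟸ Z ∧ H♭^c (PROVED) — the leaf of the W-column `_16XHcW`. [this file, g28] -/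
def HalvingBasinPGC (aHi Λ θ s : ℝ) : Prop :=
  LatticeLiouvilleCert → LayeredLiouvilleCert → ∀ δ : ℝ, 0 < δ → ∀ a : ℝ, 0 < a → ∃ κ₀ : ℝ, 0 < κ₀ ∧ ∃ M : ℝ, 1 ≤ M ∧ ∃ R₀ : ℝ, 0 < R₀ ∧
    ∀ S : Set E3, IsDoorSetPG aHi δ S → (∀ q ∈ S, IsTwoShellAffineGood θ S q) →
      ∀ η : ℝ, 0 < η → η ≤ κ₀ → ∀ R : ℝ, R₀ ≤ R →
        NearHomL2BDC a s Λ η 4 S (atomsIn (μS S) 0 (M * R)) → NearHomL2BD Λ (η / 2) 4 S (atomsIn (μS S) 0 R)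

/-- seam: K_G ⇒ K^ℓ. [this file, g28] -/
theorem coreExclusionPGL_of_PG {aHi Λ θ s : ℝ} (h : CoreExclusionPG aHi Λ θ) : CoreExclusionPGL aHi Λ θ s := by
  intro hL hL' δ hδ a _
  obtain ⟨C, hC, M, hM, hrest⟩ := h hL hL' δ hδ
  refine ⟨C, hC, M, hM, fun τ₀ hτ₀ => ?_⟩
  obtain ⟨κ₁, hκ₁, R₀, hR₀, hS⟩ := hrest τ₀ hτ₀
  exact ⟨κ₁, hκ₁, R₀, hR₀, fun S hSd hg η hη hηle R hR hflat => hS S hSd hg η hη hηle R hR (nearHomL2BD_of_confL hflat)⟩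

/-- seam: K^ℓ ⇒ K_G^c. [this file, g28] -/
theorem coreExclusionPGC_of_PGL {aHi Λ θ s : ℝ} (h : CoreExclusionPGL aHi Λ θ s) : CoreExclusionPGC aHi Λ θ s := by
  intro hL hL' δ hδ a ha
  obtain ⟨C, hC, M, hM, hrest⟩ := h hL hL' δ hδ a ha
  refine ⟨C, hC, M, hM, fun τ₀ hτ₀ => ?_⟩
  obtain ⟨κ₁, hκ₁, R₀, hR₀, hS⟩ := hrest τ₀ hτ₀
  exact ⟨κ₁, hκ₁, R₀, hR₀, fun S hSd hg η hη hηle R hR hflat => hS S hSd hg η hη hηle R hR (nearHomL2BDL_of_conf hflat)⟩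

/-- seam: H_pert,G ⇒ H_pert^ℓ. [this file, g28] -/
theorem perturbativeDecayPGL_of_PG {aHi Λ θ s : ℝ} (h : PerturbativeDecayPG aHi Λ θ) : PerturbativeDecayPGL aHi Λ θ s := by
  intro hL hL' δ hδ a _ c hc
  obtain ⟨τ₀, hτ₀, κ₀, hκ₀, M, hM, R₀, hR₀, hS⟩ := h hL hL' δ hδ c hc
  exact ⟨τ₀, hτ₀, κ₀, hκ₀, M, hM, R₀, hR₀, fun S hSd hg η hη hηle R hR hflat => hS S hSd hg η hη hηle R hR (nearHomL2SupBD_of_confL hflat)⟩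

/-- seam: H_pert^ℓ ⇒ H_pert,G^c. [this file, g28] -/
theorem perturbativeDecayPGC_of_PGL {aHi Λ θ s : ℝ} (h : PerturbativeDecayPGL aHi Λ θ s) : PerturbativeDecayPGC aHi Λ θ s := by
  intro hL hL' δ hδ a ha c hc
  obtain ⟨τ₀, hτ₀, κ₀, hκ₀, M, hM, R₀, hR₀, hS⟩ := h hL hL' δ hδ a ha c hc
  exact ⟨τ₀, hτ₀, κ₀, hκ₀, M, hM, R₀, hR₀, fun S hSd hg η hη hηle R hR hflat => hS S hSd hg η hη hηle R hR (nearHomL2SupBDL_of_conf hflat)⟩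

/-- seam: H♭_G ⇒ H♭^ℓ. [this file, g28] -/
theorem halvingBasinPGL_of_PG {aHi Λ θ s : ℝ} (h : HalvingBasinPG aHi Λ θ) : HalvingBasinPGL aHi Λ θ s := by
  intro hL hL' δ hδ a _
  obtain ⟨κ₀, hκ₀, M, hM, R₀, hR₀, hS⟩ := h hL hL' δ hδ
  exact ⟨κ₀, hκ₀, M, hM, R₀, hR₀, fun S hSd hg η hη hηle R hR hflat => hS S hSd hg η hη hηle R hR (nearHomL2BD_of_confL hflat)⟩

/-- seam: H♭^ℓ ⇒ H♭^c. [this file, g28] -/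
theorem halvingBasinPGC_of_PGL {aHi Λ θ s : ℝ} (h : HalvingBasinPGL aHi Λ θ s) : HalvingBasinPGC aHi Λ θ s := by
  intro hL hL' δ hδ a ha
  obtain ⟨κ₀, hκ₀, M, hM, R₀, hR₀, hS⟩ := h hL hL' δ hδ a ha
  exact ⟨κ₀, hκ₀, M, hM, R₀, hR₀, fun S hSd hg η hη hηle R hR hflat => hS S hSd hg η hη hηle R hR (nearHomL2BDL_of_conf hflat)⟩

/-! ## §I.6  ★ Glue (PROVED): rigid localisation ∧ rigid-chart piece ⇒ the GSC piece -/

/-- ★ **K_G ⟸ Z_L ∧ K^ℓ**. [this file, g28] -/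
theorem coreExclusionPG_of_confL {aHi Λ θ s : ℝ} (hZ : ConformalChartLocalisationPG aHi Λ θ s) (hK : CoreExclusionPGL aHi Λ θ s) :
    CoreExclusionPG aHi Λ θ := by
  intro hL hL' δ hδ
  obtain ⟨a, ha, ηz, hηz, Rz, hRz, hZ'⟩ := hZ δ hδ
  obtain ⟨C, hC, M, hM, hrest⟩ := hK hL hL' δ hδ a ha
  refine ⟨C, hC, M, hM, fun τ₀ hτ₀ => ?_⟩
  obtain ⟨κ₁, hκ₁, R₀, hR₀, hS⟩ := hrest τ₀ hτ₀
  refine ⟨min κ₁ ηz, lt_min hκ₁ hηz, max R₀ Rz, lt_max_of_lt_left hR₀, fun S hSd hg η hη hηle R hR hflat => ?_⟩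
  have hR₀R : R₀ ≤ R := (le_max_left _ _).trans hR
  have hRzR : Rz ≤ R := (le_max_right _ _).trans hR
  have hRpos : 0 < R := hRz.trans_le hRzR
  have hMR : Rz ≤ M * R := hRzR.trans (le_mul_of_one_le_left hRpos.le hM)
  exact hS S hSd hg η hη (hηle.trans (min_le_left _ _)) R hR₀R (hZ' S hSd hg η hη (hηle.trans (min_le_right _ _)) (M * R) hMR hflat)

/-- ★ **H_pert,G ⟸ Z_L^sup ∧ H_pert^ℓ**. [this file, g28] -/
theorem perturbativeDecayPG_of_confL {aHi Λ θ s : ℝ} (hZ : ConformalChartLocalisationSupPG aHi Λ θ s) (hP : PerturbativeDecayPGL aHi Λ θ s) :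
    PerturbativeDecayPG aHi Λ θ := by
  intro hL hL' δ hδ c hc
  obtain ⟨a, ha, ηz, hηz, Rz, hRz, hZ'⟩ := hZ δ hδ
  obtain ⟨τ₀, hτ₀, κ₀, hκ₀, M, hM, R₀, hR₀, hS⟩ := hP hL hL' δ hδ a ha c hc
  refine ⟨τ₀, hτ₀, min κ₀ ηz, lt_min hκ₀ hηz, M, hM, max R₀ Rz, lt_max_of_lt_left hR₀, fun S hSd hg η hη hηle R hR hflat => ?_⟩
  have hR₀R : R₀ ≤ R := (le_max_left _ _).trans hR
  have hRzR : Rz ≤ R := (le_max_right _ _).trans hR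
  have hRpos : 0 < R := hRz.trans_le hRzR
  have hMR : Rz ≤ M * R := hRzR.trans (le_mul_of_one_le_left hRpos.le hM)
  exact hS S hSd hg η hη (hηle.trans (min_le_left _ _)) R hR₀R (hZ' S hSd hg η hη (hηle.trans (min_le_right _ _)) (M * R) hMR τ₀ hτ₀ hflat)

/-- ★★ **H♭_G ⟸ Z_L ∧ H♭^ℓ (PROVED)** — the sup-free column glue: rigid localisation by energy, then the one-step halving under a conformal chart. [this file, g28] -/
theorem halvingBasinPG_of_confL {aHi Λ θ s : ℝ} (hZ : ConformalChartLocalisationPG aHi Λ θ s) (hH : HalvingBasinPGL aHi Λ θ s) :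
    HalvingBasinPG aHi Λ θ := by
  intro hL hL' δ hδ
  obtain ⟨a, ha, ηz, hηz, Rz, hRz, hZ'⟩ := hZ δ hδ
  obtain ⟨κ₀, hκ₀, M, hM, R₀, hR₀, hS⟩ := hH hL hL' δ hδ a ha
  refine ⟨min κ₀ ηz, lt_min hκ₀ hηz, M, hM, max R₀ Rz, lt_max_of_lt_left hR₀, fun S hSd hg η hη hηle R hR hflat => ?_⟩
  have hR₀R : R₀ ≤ R := (le_max_left _ _).trans hR
  have hRzR : Rz ≤ R := (le_max_right _ _).trans hR
  have hRpos : 0 < R := hRz.trans_le hRzR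
  have hMR : Rz ≤ M * R := hRzR.trans (le_mul_of_one_le_left hRpos.le hM)
  exact hS S hSd hg η hη (hηle.trans (min_le_left _ _)) R hR₀R (hZ' S hSd hg η hη (hηle.trans (min_le_right _ _)) (M * R) hMR hflat)

/-- ★ **H♭_G ⟸ Z ∧ H♭^c (PROVED)** — the core-tube variant (for the W-columns). [this file, g28] -/
theorem halvingBasinPG_of_conf {aHi Λ θ s : ℝ} (hZ : ConformalLocalisationPG aHi Λ θ s) (hH : HalvingBasinPGC aHi Λ θ s) :
    HalvingBasinPG aHi Λ θ := by
  intro hL hL' δ hδ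
  obtain ⟨a, ha, ηz, hηz, Rz, hRz, hZ'⟩ := hZ δ hδ
  obtain ⟨κ₀, hκ₀, M, hM, R₀, hR₀, hS⟩ := hH hL hL' δ hδ a ha
  refine ⟨min κ₀ ηz, lt_min hκ₀ hηz, M, hM, max R₀ Rz, lt_max_of_lt_left hR₀, fun S hSd hg η hη hηle R hR hflat => ?_⟩
  have hR₀R : R₀ ≤ R := (le_max_left _ _).trans hR
  have hRzR : Rz ≤ R := (le_max_right _ _).trans hR
  have hRpos : 0 < R := hRz.trans_le hRzR
  have hMR : Rz ≤ M * R := hRzR.trans (le_mul_of_one_le_left hRpos.le hM)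
  exact hS S hSd hg η hη (hηle.trans (min_le_left _ _)) R hR₀R (hZ' S hSd hg η hη (hηle.trans (min_le_right _ _)) (M * R) hMR hflat)

/-- ★ **NOTHING LOST against the sup-route: H♭_G ⟸ Z_L ∧ Z_L^sup ∧ K^ℓ ∧ H_pert^ℓ (PROVED)** — the K/H_pert pair with rigid-chart hypotheses composes back to the
one-step halving through the tree's `halvingBasinPG_of_perturbative_core`; the single leaf H♭^ℓ asks for less (no sup bound produced or consumed). [this file, g28] -/
theorem halvingBasinPG_of_confL_pair {aHi Λ θ s : ℝ} (hZ : ConformalChartLocalisationPG aHi Λ θ s) (hZ' : ConformalChartLocalisationSupPG aHi Λ θ s)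
    (hK : CoreExclusionPGL aHi Λ θ s) (hP : PerturbativeDecayPGL aHi Λ θ s) : HalvingBasinPG aHi Λ θ :=
  halvingBasinPG_of_perturbative_core (perturbativeDecayPG_of_confL hZ' hP) (coreExclusionPG_of_confL hZ hK)

/-! ## §I.7  ★ Columns (rigid-chart tolerance `s = 1/50`) -/

/-- ★★★ **COLUMN `_16XHℓ` — SEVEN opaque leaves, THE COLUMN OF THIS NODE**: `LatticeLiouvilleCert → LayeredLiouvilleCert → R_G(1;2,1/16,1/16) →
X(1;2,1/16,1/16) → Z_E(1;2,1/16,1/50) → H♭^ℓ(1;2,1/16,1/50) → PeriodicBulkGapDoor 2 → VisibleGap (1/50) ∧ PertRegime (1/50)` — two linear certificates, the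
rigidity inequality, two GSC-free ENERGY leaves (X: energy controls flatness; Z_E: energy pins the rigid chart datum) and ONE regularity leaf for minimisers
(H♭^ℓ), composed through `BindingSurface` (tree) and HBG″. [this file, g28] -/
theorem gap_and_pert_1_50_of_certs_16XHl (hL : LatticeLiouvilleCert) (hL' : LayeredLiouvilleCert)
    (hR : OscRigidityL2BDPG 1 2 (1 / 16) (1 / 16)) (hX : ExcessFlatnessControlP 1 2 (1 / 16) (1 / 16))
    (hE : ExcessChartLocalisationP 1 2 (1 / 16) (1 / 50)) (hB : HalvingBasinPGL 1 2 (1 / 16) (1 / 50))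
    (hG : PeriodicBulkGapDoor 2) : VisibleGap (1 / 50) ∧ PertRegime (1 / 50) :=
  gap_and_pert_1_50_of_certs_16XBG hL hL' hR hX (halvingBasinPG_of_confL (conformalChartLocalisationPG_of_excess hE) hB) hG

/-- ★★ **COLUMN `_16XGℓ` — EIGHT opaque leaves** (the finer sup-route with rigid-chart John input): `LatticeLiouvilleCert → LayeredLiouvilleCert → R_G → X →
Z_E(1;2,1/16,1/50) → K^ℓ(1;2,1/16,1/50) → H_pert^ℓ(1;2,1/16,1/50) → PeriodicBulkGapDoor 2 → VisibleGap (1/50) ∧ PertRegime (1/50)`. [this file, g28] -/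
theorem gap_and_pert_1_50_of_certs_16XGl (hL : LatticeLiouvilleCert) (hL' : LayeredLiouvilleCert)
    (hR : OscRigidityL2BDPG 1 2 (1 / 16) (1 / 16)) (hX : ExcessFlatnessControlP 1 2 (1 / 16) (1 / 16))
    (hE : ExcessChartLocalisationP 1 2 (1 / 16) (1 / 50)) (hK : CoreExclusionPGL 1 2 (1 / 16) (1 / 50))
    (hPd : PerturbativeDecayPGL 1 2 (1 / 16) (1 / 50)) (hG : PeriodicBulkGapDoor 2) : VisibleGap (1 / 50) ∧ PertRegime (1 / 50) :=
  gap_and_pert_1_50_of_certs_16XG hL hL' hR hX (coreExclusionPG_of_confL (conformalChartLocalisationPG_of_excess hE) hK)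
    (perturbativeDecayPG_of_confL (conformalChartLocalisationSupPG_of_excess hE) hPd) hG

/-- ★★ **COLUMN `_16XHcW` — EIGHT opaque leaves** (if the soft data must localise): `LatticeLiouvilleCert → LayeredLiouvilleCert → R_G → X → Z_E(1;2,1/16,1/50) →
W(1;2,1/16,1/50) → H♭^c(1;2,1/16,1/50) → PeriodicBulkGapDoor 2 → VisibleGap (1/50) ∧ PertRegime (1/50)`. [this file, g28] -/
theorem gap_and_pert_1_50_of_certs_16XHcW (hL : LatticeLiouvilleCert) (hL' : LayeredLiouvilleCert)
    (hR : OscRigidityL2BDPG 1 2 (1 / 16) (1 / 16)) (hX : ExcessFlatnessControlP 1 2 (1 / 16) (1 / 16))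
    (hE : ExcessChartLocalisationP 1 2 (1 / 16) (1 / 50)) (hW : StackLocalisationPG 1 2 (1 / 16) (1 / 50))
    (hB : HalvingBasinPGC 1 2 (1 / 16) (1 / 50)) (hG : PeriodicBulkGapDoor 2) : VisibleGap (1 / 50) ∧ PertRegime (1 / 50) :=
  gap_and_pert_1_50_of_certs_16XBG hL hL' hR hX
    (halvingBasinPG_of_conf (conformalLocalisationPG_of_chart_stack (conformalChartLocalisationPG_of_excess hE) hW) hB) hG

/-- ★ **COLUMN `_16XGcW` — TEN opaque leaves** (part O v4's leaves with Z, Z^sup discharged modulo the soft-data localisations): `LatticeLiouvilleCert →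
LayeredLiouvilleCert → R_G → X → Z_E → W → W^sup → K_G^c → H_pert,G^c → PeriodicBulkGapDoor 2 → VisibleGap (1/50) ∧ PertRegime (1/50)` (all at `(1;2,1/16,1/50)`). [this file, g28] -/
theorem gap_and_pert_1_50_of_certs_16XGcW (hL : LatticeLiouvilleCert) (hL' : LayeredLiouvilleCert)
    (hR : OscRigidityL2BDPG 1 2 (1 / 16) (1 / 16)) (hX : ExcessFlatnessControlP 1 2 (1 / 16) (1 / 16))
    (hE : ExcessChartLocalisationP 1 2 (1 / 16) (1 / 50)) (hW : StackLocalisationPG 1 2 (1 / 16) (1 / 50))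
    (hW' : StackLocalisationSupPG 1 2 (1 / 16) (1 / 50)) (hK : CoreExclusionPGC 1 2 (1 / 16) (1 / 50))
    (hPd : PerturbativeDecayPGC 1 2 (1 / 16) (1 / 50)) (hG : PeriodicBulkGapDoor 2) : VisibleGap (1 / 50) ∧ PertRegime (1 / 50) :=
  gap_and_pert_1_50_of_certs_16XGc hL hL' hR hX
    (conformalLocalisationPG_of_chart_stack (conformalChartLocalisationPG_of_excess hE) hW)
    (conformalLocalisationSupPG_of_chart_stack (conformalChartLocalisationSupPG_of_excess hE) hW') hK hPd hG

/-- ★★ **COLUMN `_16XHℓ`, resolved form — ELEVEN leaves (the audit column)**: `LJDecay → LJMoments → CleanCrystalStability → LayeredDecay → LayeredMoments →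
LayeredCrystalStability → R_G → X → Z_E → H♭^ℓ → HBG″ → VisibleGap (1/50) ∧ PertRegime (1/50)`. [this file, g28] -/
theorem gap_and_pert_1_50_of_layered_pieces_16XHl (hD : LJDecay) (hM : LJMoments) (hC : CleanCrystalStability)
    (hD' : LayeredDecay) (hM' : LayeredMoments) (hC' : LayeredCrystalStability)
    (hR : OscRigidityL2BDPG 1 2 (1 / 16) (1 / 16)) (hX : ExcessFlatnessControlP 1 2 (1 / 16) (1 / 16))
    (hE : ExcessChartLocalisationP 1 2 (1 / 16) (1 / 50)) (hB : HalvingBasinPGL 1 2 (1 / 16) (1 / 50))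
    (hG : PeriodicBulkGapDoor 2) : VisibleGap (1 / 50) ∧ PertRegime (1 / 50) :=
  gap_and_pert_1_50_of_certs_16XHl (latticeLiouvilleCert_of (latticeLinLiouville_of hD hM) hC) (layeredLiouvilleCert_of_pieces hD' hM' hC')
    hR hX hE hB hG

end Summit.AtomisticToContinuum.Crystallization.Theorems.ChartedZeroExcessLayeredLatticeLiouville

end
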